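import Literature.AnabelianGeometry.AbsoluteAnabelian.AbsTopII.CuspidalizationInputs
import Literature.AnabelianGeometry.AbsoluteAnabelian.GeneralizedSubpadicSlimProofs
import Literature.AnabelianGeometry.AbsoluteAnabelian.GeneralizedSubpadicCyclotomicProofs
import HarnessLib

/-!
# [AbsTopII] Cor 3.7 / 3.8 with Rmk 3.7.1: the field-side hypotheses are kernel theorems for curves
# over GENERALIZED sub-`p`-adic fields — the input class is exactly the strictly Belyi curves

S. Mochizuki, *Topics in Absolute Anabelian Geometry II* [AbsTopII], Cor 3.7 p. 72, Cor 3.8 p. 74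
and Remark 3.7.1 p. 73 (= Remark 3.3.1 p. 69 for Cor 3.7: the class `𝒟` of [AbsTopI] Example 4.8
(i), base fields generalized sub-`p`-adic). Sequel of `AbsTopII/CuspidalizationInputs.lean`
(abc-iut-L4-t6; the sub-`p`-adic case): with the two generalized-sub-`p`-adic inputs of [AbsTopI]
Example 4.8 (i) now THEOREMS of the tree —

* the slimness of `G`: [Tpcs] Lemma 4.14 (`Tpcs.lem_4_14_slim_holds`, abc-iut-L4-d1, PROVED; LC1
  glue `isSlimGroup_of_iso_absoluteGaloisGrp_of_isGeneralizedSubpadicFor_holds`),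
* "the prime `p` clearly serves as a prime '`l`'" ([AbsTopI] Ex 4.8 (i) p. 58), i.e. `χ_p` has open
  image: `AbsTopIII.IsGeneralizedSubpadicFor.isOpen_range_cyclotomicChar` (abc-iut-L4-t13, PROVED) —

the standing hypotheses `IsCor37Input` of the instantiated Cor 3.7
(`AbsTopII/BelyiCuspidalization.lean`, whose `generalizedSubpadic` field IS Remark 3.7.1's `𝒟`)
reduce to their first clause: for a curve `X` over a generalized sub-`p`-adic field, `M.IsCor37Input
X ↔ M.IsStrictlyBelyiType X` (`isCor37Input_of_isGeneralizedSubpadicFor`,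
`isCor37Input_iff_strictlyBelyi`); and the common prime of Cor 3.8 for two curves over generalized
sub-`p`-adic fields for the SAME `p` is `l := p` (`commonPrime_of_isGeneralizedSubpadicFor`). The
general-`𝒟` member predicates receive the same supply. HONEST FRAMING: side hypotheses discharged;
the corollaries themselves (`Cor_3_7`, `Cor_3_8`, `Cor_3_3_*`, `Cor_3_4`) remain named hypotheses
relative to a model; nothing here bears on [IUTchIII] Cor 3.12.
-/

noncomputable section

open CategoryTheory

namespace Literature.AnabelianGeometry.AbsoluteAnabelian.AbsTopII

open Literature.AlgebraicGeometry.Frobenioids (IsSlimGroup)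
open AbsTopIII (IsGeneralizedSubpadicFor cyclotomicChar)

universe u

/-! ### Generalized sub-`p`-adic base fields -/

/-- For a generalized sub-`p`-adic field `k`, the prime `p` itself witnesses "Suppose further that,
for some `l ∈ Σ`, the cyclotomic character `G → ℤ_l^×` has open image" (Cor 3.7 p. 72) — [AbsTopI]
Ex 4.8 (i): "the prime `p` clearly serves as a prime '`l`'".
[cite: MochizukiAbsTopII2013, Rmk 3.7.1 p.73] -/
theorem exists_isOpen_range_cyclotomicChar_of_isGeneralizedSubpadicFor {k : Type u} [Field k]
    {p : ℕ} [Fact p.Prime] (hk : IsGeneralizedSubpadicFor k p) :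
    ∃ (l : ℕ) (_ : Fact l.Prime), IsOpen (Set.range (cyclotomicChar k l)) :=
  ⟨p, inferInstance, hk.isOpen_range_cyclotomicChar⟩

/-- The COMMON prime of Cor 3.8 p. 74 for two generalized sub-`p`-adic base fields with the SAME
`p`: `l := p`.  (The same-`p` restriction is genuine: for generalized sub-`p₁`-adic / sub-`p₂`-adic
fields with `p₁ ≠ p₂` a common `l` need not exist — over `Frac W(𝔽̄_p)` every `χ_l`, `l ≠ p`, is
trivial, the Teichmüller lifts putting `μ_{l^∞}` into the field; remark of abc-iut-L4-t13.  Contrast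
the sub-`p`-adic case, `commonPrime_of_isSubpadic`, where any `l` works.)
[cite: MochizukiAbsTopII2013, Cor 3.8 p.74] -/
theorem commonPrime_of_isGeneralizedSubpadicFor {k₁ k₂ : Type u} [Field k₁] [Field k₂] {p : ℕ}
    [Fact p.Prime] (hk₁ : IsGeneralizedSubpadicFor k₁ p) (hk₂ : IsGeneralizedSubpadicFor k₂ p) :
    ∃ (l : ℕ) (_ : Fact l.Prime),
      IsOpen (Set.range (cyclotomicChar k₁ l)) ∧ IsOpen (Set.range (cyclotomicChar k₂ l)) :=
  ⟨p, inferInstance, hk₁.isOpen_range_cyclotomicChar, hk₂.isOpen_range_cyclotomicChar⟩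

namespace BelyiCurveModel

variable (M : BelyiCurveModel.{u})

/-- "`G` a slim profinite group" for a curve of the model over a generalized sub-`p`-adic base
field: `G ≅ G_k` (`M.galIso`) and `G_k` is slim ([Tpcs] Lem 4.14, PROVED in the tree by
abc-iut-L4-d1). [cite: MochizukiAbsTopII2013, Cor 3.7 p.72] -/
theorem isSlimGroup_gal_of_isGeneralizedSubpadicFor (X : M.Curve) {p : ℕ} [Fact p.Prime]
    (hk : IsGeneralizedSubpadicFor (M.base X) p) : IsSlimGroup (M.ext X).gal :=
  isSlimGroup_of_iso_absoluteGaloisGrp_of_isGeneralizedSubpadicFor_holds hk (M.galIso X)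

/-- **The input class of Cor 3.7 in the generality of Rmk 3.7.1 is the class of curves of strictly
Belyi type**: for a curve `X` of strictly Belyi type over a generalized sub-`p`-adic field, every
standing hypothesis of Cor 3.7 p. 72 holds — `G` slim ([Tpcs] Lem 4.14) and `χ_p` open ([AbsTopI] Ex
4.8 (i)), both PROVED in the tree. [cite: MochizukiAbsTopII2013, Rmk 3.7.1 p.73] -/
theorem isCor37Input_of_isGeneralizedSubpadicFor {X : M.Curve} (hB : M.IsStrictlyBelyiType X)
    {p : ℕ} [Fact p.Prime] (hk : IsGeneralizedSubpadicFor (M.base X) p) : M.IsCor37Input X where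
  strictlyBelyi := hB
  generalizedSubpadic := ⟨p, inferInstance, hk⟩
  slim := M.isSlimGroup_gal_of_isGeneralizedSubpadicFor X hk
  cyclotomicallyFull := exists_isOpen_range_cyclotomicChar_of_isGeneralizedSubpadicFor hk

/-- **The fields `slim` and `cyclotomicallyFull` of `IsCor37Input` are REDUNDANT**: the typed
standing hypotheses of the instantiated Cor 3.7 are equivalent to `X` being of strictly Belyi type
over a generalized sub-`p`-adic field (Rmk 3.7.1's `𝒟`), the other two clauses being theorems.
[cite: MochizukiAbsTopII2013, Rmk 3.7.1 p.73] -/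
theorem isCor37Input_iff_strictlyBelyi_and_generalizedSubpadic (X : M.Curve) :
    M.IsCor37Input X ↔ M.IsStrictlyBelyiType X ∧
      ∃ (p : ℕ) (_ : Fact p.Prime), IsGeneralizedSubpadicFor (M.base X) p := by
  constructor
  · exact fun h => ⟨h.strictlyBelyi, h.generalizedSubpadic⟩
  · rintro ⟨hB, p, hp, hk⟩
    exact M.isCor37Input_of_isGeneralizedSubpadicFor hB hk

/-- Over a generalized sub-`p`-adic base field the input predicate of Cor 3.7 is EQUIVALENT to its
first clause. [cite: MochizukiAbsTopII2013, Rmk 3.7.1 p.73] -/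
theorem isCor37Input_iff_strictlyBelyi {X : M.Curve} {p : ℕ} [Fact p.Prime]
    (hk : IsGeneralizedSubpadicFor (M.base X) p) : M.IsCor37Input X ↔ M.IsStrictlyBelyiType X :=
  ⟨fun h => h.strictlyBelyi, fun hB => M.isCor37Input_of_isGeneralizedSubpadicFor hB hk⟩

/-- **Cor 3.7 for curves of strictly Belyi type over generalized sub-`p`-adic fields** (PROVED
reduction from the named fact `Cor_3_7`): no slimness / cyclotomic clause left.
[cite: MochizukiAbsTopII2013, Cor 3.7 pp.72-73] -/
theorem cor_3_7_of_isGeneralizedSubpadicFor (h37 : M.Cor_3_7) {X : M.Curve}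
    (hB : M.IsStrictlyBelyiType X) {p : ℕ} [Fact p.Prime]
    (hk : IsGeneralizedSubpadicFor (M.base X) p) (U : M.Open X) :
    ∃ B : BelyiCuspidalization (M.ext X), B.cusp.IsoOver (M.cuspOf U) ∧
      B.cusp.decompositionImages B.cusps = (M.cuspOf U).decompositionImages (M.cuspsOf U) :=
  h37 X (M.isCor37Input_of_isGeneralizedSubpadicFor hB hk) U

/-- **Cor 3.8 for two curves of strictly Belyi type over generalized sub-`p`-adic fields with the
same `p`** (PROVED reduction from the named fact `Cor_3_8`; the common prime is `l := p`).
[cite: MochizukiAbsTopII2013, Cor 3.8 p.74] -/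
theorem cor_3_8_of_isGeneralizedSubpadicFor (h38 : M.Cor_3_8) {X₁ X₂ : M.Curve} {p : ℕ}
    [Fact p.Prime] (hB₁ : M.IsStrictlyBelyiType X₁) (hk₁ : IsGeneralizedSubpadicFor (M.base X₁) p)
    (hB₂ : M.IsStrictlyBelyiType X₂) (hk₂ : IsGeneralizedSubpadicFor (M.base X₂) p)
    (φ : (M.ext X₁).arith ≃ₜ* (M.ext X₂).arith)
    (hφ : (M.ext X₁).geom.map φ.toMonoidHom = (M.ext X₂).geom) (U₁ : M.Open X₁) :
    ∃ U₂ : M.Open X₂,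
      (∃ φU : (M.cuspOf U₁).ext.arith ≃ₜ* (M.cuspOf U₂).ext.arith,
          ∀ x, (M.cuspOf U₂).hom.arith (φU x) = φ ((M.cuspOf U₁).hom.arith x)) ∧
      ∀ φU φU' : (M.cuspOf U₁).ext.arith ≃ₜ* (M.cuspOf U₂).ext.arith,
        (∀ x, (M.cuspOf U₂).hom.arith (φU x) = φ ((M.cuspOf U₁).hom.arith x)) →
        (∀ x, (M.cuspOf U₂).hom.arith (φU' x) = φ ((M.cuspOf U₁).hom.arith x)) →
          ∃ g : (M.cuspOf U₂).ext.arith, (M.cuspOf U₂).hom.arith g = 1 ∧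
            ∀ x, φU' x = g * φU x * g⁻¹ :=
  h38 X₁ X₂ (M.isCor37Input_of_isGeneralizedSubpadicFor hB₁ hk₁)
    (M.isCor37Input_of_isGeneralizedSubpadicFor hB₂ hk₂)
    (commonPrime_of_isGeneralizedSubpadicFor hk₁ hk₂) φ hφ U₁

end BelyiCurveModel

/-! ### Members of a class `𝒟` over generalized sub-`p`-adic construction-data fields -/

section ConstructionData

open AbsTopI

variable {𝒟 : ConstructionDataClass.{u}}

/-- For a member over a generalized sub-`p`-adic construction-data field `k_b`, the group `G`
(literally `Gal(k̄_b/k_b)`) is slim ([Tpcs] Lem 4.14, PROVED in the tree). [cite: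
MochizukiAbsTopII2013, Rmk 3.7.1 p.73] -/
theorem isSlimGroup_gal_ext_of_isGeneralizedSubpadicFor (b : 𝒟.Base) (X : (𝒟.datum b).Obj)
    {p : ℕ} [Fact p.Prime] (hk : IsGeneralizedSubpadicFor (𝒟.fld b) p) :
    IsSlimGroup ((𝒟.datum b).ext X).gal :=
  isSlimGroup_of_iso_absoluteGaloisGrp_of_isGeneralizedSubpadicFor_holds hk (Iso.refl _)

namespace BelyiModel

variable (M : BelyiModel 𝒟)

/-- **The standing hypotheses of Cor 3.7 for a member over a generalized sub-`p`-adic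
construction-data field** (Rmk 3.7.1's `𝒟`): membership, `Σ` = all primes, strictly Belyi type and
slim nontrivial `Δ` are the INPUTS; the slimness of `G` ([Tpcs] Lem 4.14) and the open image of
`χ_p` ([AbsTopI] Ex 4.8 (i)) are SUPPLIED by theorems of the tree.
[cite: MochizukiAbsTopII2013, Rmk 3.7.1 p.73] -/
theorem isCor37Member_of_isGeneralizedSubpadicFor {b : 𝒟.Base} {X : (𝒟.datum b).Obj}
    (hmem : 𝒟.Mem b X) (hprimes : (𝒟.datum b).primes = Set.univ)
    (hB : M.IsStrictlyBelyiType b X) {p : ℕ} [Fact p.Prime]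
    (hk : IsGeneralizedSubpadicFor (𝒟.fld b) p) (hΔ : IsSlimGroup ((𝒟.datum b).ext X).geom)
    (hne : ((𝒟.datum b).ext X).geom ≠ ⊥) : M.IsCor37Member b X where
  mem := hmem
  primes_eq := hprimes
  strictlyBelyi := hB
  slim := isSlimGroup_gal_ext_of_isGeneralizedSubpadicFor b X hk
  cyclotomic := exists_isOpen_range_cyclotomicChar_of_isGeneralizedSubpadicFor hk
  geom_slim := hΔ
  geom_ne_bot := hne

/-- **Over the class of [AbsTopI] Example 4.8 (i) LITERALLY** (abc-iut-L4-t13's `IsEx48ClassGen p`: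
every `k_b` generalized sub-`p`-adic, `p ∈ Σ_b`, members = hyperbolic orbicurves) the standing
hypotheses of Cor 3.7 need only membership, `Σ` = all primes, strictly Belyi type and slim
nontrivial `Δ` — UNCONDITIONAL version of `isCor37Member_of_ex_4_8_i`
(`CuspidalizationComparison.lean`), which took the named fact `Ex_4_8_i`; its slimness and
cyclotomic clauses are now theorems. [cite: MochizukiAbsTopII2013, Rmk 3.7.1 p.73] -/
theorem isCor37Member_of_isEx48ClassGen {p : ℕ} [Fact p.Prime] (h𝒟 : 𝒟.IsEx48ClassGen p)
    {b : 𝒟.Base} {X : (𝒟.datum b).Obj} (hmem : 𝒟.Mem b X)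
    (hprimes : (𝒟.datum b).primes = Set.univ) (hB : M.IsStrictlyBelyiType b X)
    (hΔ : IsSlimGroup ((𝒟.datum b).ext X).geom) (hne : ((𝒟.datum b).ext X).geom ≠ ⊥) :
    M.IsCor37Member b X :=
  M.isCor37Member_of_isGeneralizedSubpadicFor hmem hprimes hB (h𝒟.generalizedSubpadic b) hΔ hne

end BelyiModel

namespace EllipticModel

variable (M : EllipticModel 𝒟)

/-- **The standing hypotheses of Cor 3.3 / 3.4 for a member over a generalized sub-`p`-adic
construction-data field with `p ∈ Σ`** (Rmk 3.3.1's `𝒟`: "sets of prime numbers containing `p`"):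
the slimness of `G` and the open image of `χ_p` are SUPPLIED by theorems of the tree.
[cite: MochizukiAbsTopII2013, Rmk 3.3.1 p.69] -/
theorem isCor33Member_of_isGeneralizedSubpadicFor {b : 𝒟.Base} {X : (𝒟.datum b).Obj}
    (hmem : 𝒟.Mem b X) (hX : M.IsEllipticallyAdmissible b X) {p : ℕ} [Fact p.Prime]
    (hk : IsGeneralizedSubpadicFor (𝒟.fld b) p) (hp : p ∈ (𝒟.datum b).primes)
    (hΔ : IsSlimGroup ((𝒟.datum b).ext X).geom) (hne : ((𝒟.datum b).ext X).geom ≠ ⊥) :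
    M.IsCor33Member b X where
  mem := hmem
  ellipticallyAdmissible := hX
  slim := isSlimGroup_gal_ext_of_isGeneralizedSubpadicFor b X hk
  cyclotomic := ⟨p, inferInstance, hp, hk.isOpen_range_cyclotomicChar⟩
  geom_slim := hΔ
  geom_ne_bot := hne

/-- **Over the class of [AbsTopI] Example 4.8 (i) LITERALLY** (`IsEx48ClassGen p`: `p ∈ Σ_b` is
`h𝒟.mem_primes b`, `k_b` generalized sub-`p`-adic is `h𝒟.generalizedSubpadic b`) the standing
hypotheses of Cor 3.3 / 3.4 need only membership, `Π`-elliptic admissibility and slim nontrivial `Δ`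
— UNCONDITIONAL version of `isCor33Member_of_ex_4_8_i` (`EllipticCuspidalizationComparison.lean`).
[cite: MochizukiAbsTopII2013, Rmk 3.3.1 p.69] -/
theorem isCor33Member_of_isEx48ClassGen {p : ℕ} [Fact p.Prime] (h𝒟 : 𝒟.IsEx48ClassGen p)
    {b : 𝒟.Base} {X : (𝒟.datum b).Obj} (hmem : 𝒟.Mem b X) (hX : M.IsEllipticallyAdmissible b X)
    (hΔ : IsSlimGroup ((𝒟.datum b).ext X).geom) (hne : ((𝒟.datum b).ext X).geom ≠ ⊥) :
    M.IsCor33Member b X :=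
  M.isCor33Member_of_isGeneralizedSubpadicFor hmem hX (h𝒟.generalizedSubpadic b) (h𝒟.mem_primes b)
    hΔ hne

end EllipticModel

end ConstructionData

end Literature.AnabelianGeometry.AbsoluteAnabelian.AbsTopII
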